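import Mathlib
import Summits.QuantumFields.BalabanUV.Beta.AccretiveCombesThomas
import Literature.MathematicalPhysics.QuantumFieldTheory.Balaban1983to89.B13PerturbativeStep

/-!
# `Summit.QuantumFields.BalabanUV.Beta.AccretiveCombesThomasAnalytic` — the ANALYTIC-FAMILY layer of the
# accretive Combes–Thomas bound: entries of `σ ↦ A(σ)⁻¹` are holomorphic where `A` is entrywise holomorphic and
# invertible; uniform conjugated coercivity on a disc gives ONE `σ`-uniform exponentially localised majorant;
# END = the (2.16)-shape bound for the inverse family through `B13PerturbativeStep` BY NAME

HONEST FRAMING (page 1 of everything in this cell).  Discharging `FlowStep.BetaPertH` would make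
Bałaban's ultraviolet stability UNCONDITIONAL — a constructive-QFT result; it is NOT the continuum
limit and NOT the Clay problem.  This module discharges nothing of `BetaPertH`; [folklore] analysis
(Cramer's rule; Cauchy ∕ Schwarz estimate), kernel-checked (unit `b2b-balaban-beta-d4-p3`, road P3, gen 3;
third kernel leaf of the road's re-cut of NODE A = (T1)(i)(ii) ⇐ (T2) G-IF-10 ⇐ (T3) G-B9-10 of the census
`BETA/REMAINDER-BETA.md` §9).
HONEST DEPENDENCY: continuum YM on T⁴ ⇐ BetaPertH ∧ nine spine estimates (0/9 proved); BetaPertH ⇐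
(D1) ∧ (D4) ∧ CAP+tail; G-an2-4 gates asym, D1 and NE2/3/4.

WHAT THE CONSUMER ASKS.  `B13PerturbativeStep` §7 (b13-g5, C-B13-13a) isolates the leaf (2.16) of [II] =
B13 (CMP 116) p. 15 as: GIVEN `ha : ∀ i j, DifferentiableOn ℂ (σ ↦ A σ i j) (ball 0 R)` and ONE localised
majorant `hm : ‖A σ i j‖ ≤ m i j`, `Σ_j m i j e^{κ d(i,j)} ≤ ρ`, uniform on the disc, the difference `A σ − A 0`
obeys the (2.16)-type bound `WRS κ d (A σ − A 0) (2ρ/R·|σ|)` («what remains of the leaf after this theorem is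
the analyticity + uniform localisation itself»).  For families that are INVERSES of explicitly holomorphic,
uniformly accretive kernels this module supplies both hypotheses:
* §1 `differentiableOn_det ∕ _adjugate_apply ∕ _inv_apply` — holomorphy of `det A(σ)`, of the adjugate
  entries, and of the entries of `A(σ)⁻¹` on any set where `A` is entrywise holomorphic and invertible
  (Cramer: `A⁻¹ = (det A)⁻¹ • adj A`, `Matrix.inv_def`);
* §2 `norm_inv_apply_le_uniform` — conjugated coercivity with ONE constant `m` along the weights `d(·,j)`,
  uniformly in `σ` on the disc (obtained from the budget of `AccretiveCombesThomas(Budget)` with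
  `σ`-independent defect bounds), gives the `σ`-uniform majorant `‖A(σ)⁻¹(i,j)‖ ≤ m⁻¹e^{−κd(i,j)}`;
* §3 END `wrs_inv_sub_inv_zero` — `WRS κ′ d (A(σ)⁻¹ − A(0)⁻¹) (2(L/m)/R·‖σ‖)` for every `σ` in the disc, at
  any rate `κ′` with lattice-sum profile `Σ_j e^{−(κ−κ′)d(i,j)} ≤ L` (`WRS.sub_apply_zero_of_differentiableOn` ∘
  `WRS.of_entrywise`-shape, BY NAME), and `wrs_inv_sub_inv_line` — the same along any complex LINE
  `σ ↦ A(p₀ + σ•v)` of a several-parameter family (the «(U′, J, σ) at once» item of `B13PerturbativeStep`'s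
  «still not typed» list, for differences along one direction at a time).
WHAT IS NOT HERE: the instantiation on Bałaban's operators (which kernels, which `d`, which `m` — the business
of the NODE A leaves that construct the complexified local operators of [II] §2 ∕ B9 Sect. E); the
random-walk (localisation-in-`U`) structure (G-IF-10 ∕ G-B9-10 proper) — this layer gives analyticity and
uniform DECAY of inverse families, not walk expansions.

ABSOLUTE RULE.  Nothing printed is cited as a fact; nothing of other lineages is restated (BY NAME:
`B13PerturbativeStep.WRS`, `WRS.sub_apply_zero_of_differentiableOn`, `B5Prop11Lower.nsq`).  NOT summit progress.
-/

open scoped BigOperators Matrix ComplexConjugate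
open Finset Complex Matrix Metric

namespace Summit.QuantumFields.BalabanUV.Beta.AccretiveCombesThomasAnalytic

open Summit.QuantumFields.BalabanUV.Beta.AccretiveCombesThomas
open Literature.MathematicalPhysics.QuantumFieldTheory.Balaban1983to89.B5Prop11Lower (nsq nsq_nonneg)
open Literature.MathematicalPhysics.QuantumFieldTheory.Balaban1983to89.B13PerturbativeStep (WRS)
open Literature.MathematicalPhysics.QuantumFieldTheory.Balaban1983to89 (B13PerturbativeStep.WRS.sub_apply_zero_of_differentiableOn)

noncomputable section

variable {ι : Type*} [Fintype ι] [DecidableEq ι]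

/-! ## §1 Holomorphy of `det`, of the adjugate and of the inverse entries of an entrywise holomorphic family -/

/-- `σ ↦ det A(σ)` is holomorphic where every entry is (Leibniz expansion: a polynomial in the entries).
[folklore] -/
theorem differentiableOn_det {A : ℂ → Matrix ι ι ℂ} {U : Set ℂ}
    (hA : ∀ i j, DifferentiableOn ℂ (fun σ => A σ i j) U) :
    DifferentiableOn ℂ (fun σ => (A σ).det) U := by
  have h : (fun σ => (A σ).det)
      = fun σ => ∑ π : Equiv.Perm ι, ((Equiv.Perm.sign π : ℤ) : ℂ) * ∏ i, A σ (π i) i := by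
    funext σ; rw [Matrix.det_apply']
  rw [h]
  refine DifferentiableOn.fun_sum fun π _ => ?_
  refine DifferentiableOn.const_mul ?_ _
  exact DifferentiableOn.fun_finsetProd fun i _ => hA (π i) i

/-- The adjugate entries `σ ↦ adj A(σ) i j` are holomorphic where every entry of `A` is (each is the
determinant of `A` with one row replaced by a constant coordinate vector). [folklore] -/
theorem differentiableOn_adjugate_apply {A : ℂ → Matrix ι ι ℂ} {U : Set ℂ}
    (hA : ∀ i j, DifferentiableOn ℂ (fun σ => A σ i j) U) (i j : ι) :
    DifferentiableOn ℂ (fun σ => (A σ).adjugate i j) U := by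
  have h : (fun σ => (A σ).adjugate i j) = fun σ => ((A σ).updateRow j (Pi.single i 1)).det := by
    funext σ; rw [Matrix.adjugate_apply]
  rw [h]
  refine differentiableOn_det fun i' j' => ?_
  by_cases hij : i' = j
  · subst hij
    have : (fun σ => (A σ).updateRow i' (Pi.single i (1 : ℂ)) i' j')
        = fun _ : ℂ => (Pi.single i (1 : ℂ) : ι → ℂ) j' := by
      funext σ; rw [Matrix.updateRow_self]
    rw [this]
    exact differentiableOn_const _
  · have : (fun σ => (A σ).updateRow j (Pi.single i (1 : ℂ)) i' j') = fun σ => A σ i' j' := by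
      funext σ; rw [Matrix.updateRow_ne hij]
    rw [this]
    exact hA i' j'

/-- **The inverse entries `σ ↦ A(σ)⁻¹ i j` are holomorphic** on any set where `A` is entrywise holomorphic and
invertible (Cramer: `A⁻¹ = (det A)⁻¹ • adj A`). [folklore] -/
theorem differentiableOn_inv_apply {A : ℂ → Matrix ι ι ℂ} {U : Set ℂ}
    (hA : ∀ i j, DifferentiableOn ℂ (fun σ => A σ i j) U) (hU : ∀ σ ∈ U, IsUnit (A σ)) (i j : ι) :
    DifferentiableOn ℂ (fun σ => (A σ)⁻¹ i j) U := by
  have h : (fun σ => (A σ)⁻¹ i j) = fun σ => ((A σ).det)⁻¹ * (A σ).adjugate i j := by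
    funext σ
    rw [Matrix.inv_def, Ring.inverse_eq_inv, Matrix.smul_apply, smul_eq_mul]
  rw [h]
  refine DifferentiableOn.mul ?_ (differentiableOn_adjugate_apply hA i j)
  refine (differentiableOn_det hA).inv fun σ hσ => ?_
  exact ((Matrix.isUnit_iff_isUnit_det (A σ)).mp (hU σ hσ)).ne_zero

/-! ## §2 One `σ`-uniform exponentially localised majorant of the inverse family -/

/-- **Uniform localisation of the inverse family**: conjugated coercivity with ONE constant `m > 0` along the
weights `d(·, j)` (rate `κ ≥ 0`, `d(j,j) = 0`), for every `σ` in a set `S`, gives the `σ`-uniform majorant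
`‖A(σ)⁻¹(i,j)‖ ≤ m⁻¹e^{−κ d(i,j)}` on `S` (`AccretiveCombesThomas.norm_inv_apply_le` pointwise in `σ`). [folklore] -/
theorem norm_inv_apply_le_uniform {A : ℂ → Matrix ι ι ℂ} {S : Set ℂ} (d : ι → ι → ℝ) (hd0 : ∀ j, d j j = 0)
    {κ m : ℝ} (hκ : 0 ≤ κ) (hm : 0 < m)
    (hc : ∀ σ ∈ S, ∀ j, ∀ z : ι → ℂ, m * nsq z ≤ (conjForm (A σ) κ (fun e => d e j) z).re)
    {σ : ℂ} (hσ : σ ∈ S) (i j : ι) :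
    ‖(A σ)⁻¹ i j‖ ≤ Real.exp (-(κ * d i j)) / m :=
  norm_inv_apply_le (A σ) d hd0 hκ hm (hc σ hσ) i j

/-- Invertibility of every member of the family on `S` (from conjugated coercivity at any one column weight).
[folklore] -/
theorem isUnit_uniform {A : ℂ → Matrix ι ι ℂ} {S : Set ℂ} [Nonempty ι] (d : ι → ι → ℝ) {κ m : ℝ} (hm : 0 < m)
    (hc : ∀ σ ∈ S, ∀ j, ∀ z : ι → ℂ, m * nsq z ≤ (conjForm (A σ) κ (fun e => d e j) z).re)
    {σ : ℂ} (hσ : σ ∈ S) : IsUnit (A σ) :=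
  isUnit_of_conjCoercive hm (hc σ hσ (Classical.arbitrary ι))

/-! ## §3 END: the (2.16)-shape bound for the inverse family, BY NAME through `B13PerturbativeStep` -/

/-- **(2.16)-shape for INVERSE families.**  Let `σ ↦ A(σ)` be entrywise holomorphic on the disc `|σ| < R` and
conjugated-coercive there with ONE constant `m > 0` along the weights `d(·,j)` at rate `κ ≥ 0` (`d(j,j) = 0`), and
let the lattice-sum profile `Σ_j e^{−(κ−κ′)d(i,j)} ≤ L` hold.  Then for every `σ` in the disc
`WRS κ′ d (A(σ)⁻¹ − A(0)⁻¹) (2(L/m)/R·‖σ‖)` — the difference of the propagators is `O(|σ|/R)` in the weighted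
row-sum norm at rate `κ′`.  Proof: §1 (holomorphy of the inverse entries) + §2 (uniform majorant) fed into
`B13PerturbativeStep.WRS.sub_apply_zero_of_differentiableOn` BY NAME. [folklore] -/
theorem wrs_inv_sub_inv_zero [Nonempty ι] {A : ℂ → Matrix ι ι ℂ} (d : ι → ι → ℝ) (hd0 : ∀ j, d j j = 0)
    {κ κ' m R L : ℝ} (hR : 0 < R) (hκ : 0 ≤ κ) (hm : 0 < m)
    (ha : ∀ i j, DifferentiableOn ℂ (fun σ => A σ i j) (ball 0 R))
    (hc : ∀ σ ∈ ball (0 : ℂ) R, ∀ j, ∀ z : ι → ℂ, m * nsq z ≤ (conjForm (A σ) κ (fun e => d e j) z).re)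
    (hL : ∀ i, ∑ j, Real.exp (-((κ - κ') * d i j)) ≤ L) {σ : ℂ} (hσ : σ ∈ ball (0 : ℂ) R) :
    WRS κ' d ((A σ)⁻¹ - (A 0)⁻¹) (2 * (L / m) / R * ‖σ‖) := by
  have hU : ∀ τ ∈ ball (0 : ℂ) R, IsUnit (A τ) := fun τ hτ => isUnit_uniform d hm hc hτ
  have ha' : ∀ i j, DifferentiableOn ℂ (fun τ => (A τ)⁻¹ i j) (ball 0 R) :=
    fun i j => differentiableOn_inv_apply ha hU i j
  have hm' : ∀ τ ∈ ball (0 : ℂ) R, ∀ i j, ‖(A τ)⁻¹ i j‖ ≤ Real.exp (-(κ * d i j)) / m :=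
    fun τ hτ i j => norm_inv_apply_le_uniform d hd0 hκ hm hc hτ i j
  have hρ : ∀ i, ∑ j, Real.exp (-(κ * d i j)) / m * Real.exp (κ' * d i j) ≤ L / m := by
    intro i
    calc ∑ j, Real.exp (-(κ * d i j)) / m * Real.exp (κ' * d i j)
        = (∑ j, Real.exp (-((κ - κ') * d i j))) / m := by
          rw [Finset.sum_div]
          refine Finset.sum_congr rfl fun j _ => ?_
          rw [div_mul_eq_mul_div, ← Real.exp_add]
          ring_nf
      _ ≤ L / m := div_le_div_of_nonneg_right (hL i) hm.le
  exact B13PerturbativeStep.WRS.sub_apply_zero_of_differentiableOn (A := fun τ => (A τ)⁻¹) hR ha' hm' hρ hσ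

/-- **Along a complex LINE of a several-parameter family.**  For `A : P → Matrix` on a complex normed space `P`
(e.g. the triple `(𝐔′, 𝐉, σ)`), a base point `p₀` and a direction `v` with `‖v‖ ≤ 1`: if `σ ↦ A(p₀ + σ•v)` is
entrywise holomorphic on `|σ| < R` and the conjugated coercivity holds with one constant on the ball
`‖p − p₀‖ < R` of `P`, then the (2.16)-shape bound holds for `A(p₀ + σ•v)⁻¹ − A(p₀)⁻¹` — differences along one
direction at a time, the form in which [II] p. 15 uses them. [folklore] -/
theorem wrs_inv_sub_inv_line [Nonempty ι] {P : Type*} [NormedAddCommGroup P] [NormedSpace ℂ P]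
    {A : P → Matrix ι ι ℂ} (p₀ v : P) (hv : ‖v‖ ≤ 1) (d : ι → ι → ℝ) (hd0 : ∀ j, d j j = 0)
    {κ κ' m R L : ℝ} (hR : 0 < R) (hκ : 0 ≤ κ) (hm : 0 < m)
    (ha : ∀ i j, DifferentiableOn ℂ (fun σ : ℂ => A (p₀ + σ • v) i j) (ball 0 R))
    (hc : ∀ p ∈ ball p₀ R, ∀ j, ∀ z : ι → ℂ, m * nsq z ≤ (conjForm (A p) κ (fun e => d e j) z).re)
    (hL : ∀ i, ∑ j, Real.exp (-((κ - κ') * d i j)) ≤ L) {σ : ℂ} (hσ : σ ∈ ball (0 : ℂ) R) :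
    WRS κ' d ((A (p₀ + σ • v))⁻¹ - (A p₀)⁻¹) (2 * (L / m) / R * ‖σ‖) := by
  have hline : ∀ τ ∈ ball (0 : ℂ) R, p₀ + τ • v ∈ ball p₀ R := by
    intro τ hτ
    rw [mem_ball, dist_eq_norm, add_sub_cancel_left, norm_smul]
    rw [mem_ball, dist_zero_right] at hτ
    calc ‖τ‖ * ‖v‖ ≤ ‖τ‖ * 1 := mul_le_mul_of_nonneg_left hv (norm_nonneg _)
      _ < R := by rw [mul_one]; exact hτ
  have h := wrs_inv_sub_inv_zero (A := fun τ : ℂ => A (p₀ + τ • v)) d hd0 hR hκ hm ha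
    (fun τ hτ => hc _ (hline τ hτ)) hL hσ
  simpa only [zero_smul, add_zero] using h

end

end Summit.QuantumFields.BalabanUV.Beta.AccretiveCombesThomasAnalytic
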